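import Summits.AtomisticToContinuum.HydrodynamicLimit.Theorems.JaynesSqueezeHardSphereLDAMeanLimit
import Summits.AtomisticToContinuum.HydrodynamicLimit.Theorems.JaynesSqueezeHardSphereLDAEos
import HarnessLib

/-!
# Hard-sphere local density approximation, VIIIa: tools for the mean empirical density

Helper file for the support item `HardSphereLDA` (stmt-AtomisticToContinuum-13459) of route
`JaynesSqueeze` (clause (B3), file VIII). Four self-contained tools:

* `gibbsMean_mono`, `gibbsMean_affine`, `avg_affine` — the canonical Gibbs mean
  `E_a[F] = Z(a)⁻¹ ∫ 𝟙 ∏ a(xᵢ) F(x) dx` is monotone and affine in the observable;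
* `gibbsMean_perturb_le` — **the convexity inequality for a perturbed field**: if the tilt `ψ`
  dominates `s(χ − κ) − T` pointwise, then
  `s E_a[(n)⁻¹∑χ] ≤ (n)⁻¹ (log Z(a e^ψ) − log Z(a)) + sκ + T` (Jensen's lower bound of file Ia);
* `integral_taylor_le` — second-order Taylor control of `∫ v(ρ + s w)` from a bound on `v″` on a band
  (file II's `abs_sub_sub_mul_le_of_deriv`, integrated);
* `tendsto_of_twoSided_perturbation` — the real-variable endgame: two-sided perturbation
  inequalities `s E_N ≤ Λ_N(s) − Λ_N(0) + sκ + A s²` (`|s| ≤ s₀`), limits `Λ_N(s) → V(s)` and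
  `|V(s) − V(0) − s(J − κ)| ≤ B s²` force `E_N → J`.

No definitions. prover-pitem-stmt-AtomisticToContinuum-13459-0.
-/

noncomputable section

namespace Summit.AtomisticToContinuum.HydrodynamicLimit.Theorems.HardSphereLDA

open MeasureTheory Filter Set Topology
open scoped ENNReal
open Literature.MathematicalPhysics.KineticTheory Literature.Analysis.FluidPDE

/-! ### The Gibbs mean: monotonicity and affine invariance -/

variable {a : T3 → ℝ} {ε : ℝ} {n : ℕ}

/-- **Monotonicity of the Gibbs mean** in the observable (bounded measurable observables, measurable
activity `0 ≤ a ≤ A`). [folklore] -/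
theorem gibbsMean_mono (ha : Measurable a) (ha0 : ∀ y, 0 ≤ a y) {A : ℝ} (hA : ∀ y, a y ≤ A)
    {f g : (Fin n → T3) → ℝ} (hf : Measurable f) (hg : Measurable g) {K : ℝ} (hfK : ∀ x, |f x| ≤ K)
    (hgK : ∀ x, |g x| ≤ K) (hle : ∀ x, f x ≤ g x) :
    (posPartition a ε n)⁻¹ * ∫ x, posWeight a ε n x * f x ≤ (posPartition a ε n)⁻¹ * ∫ x, posWeight a ε n x * g x := by
  have hA0 : 0 ≤ A := (ha0 0).trans (hA 0)
  have hwm := measurable_posWeight_of_measurable ha ε n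
  refine mul_le_mul_of_nonneg_left (integral_mono ?_ ?_ fun x => ?_) (inv_nonneg.2 (posPartition_nonneg ha0 ε n))
  · exact integrable_config_of_abs_le (hwm.mul hf) (K := A ^ n * K) fun x => by
      rw [abs_mul]; exact mul_le_mul (abs_posWeight_le ha0 hA ε x) (hfK x) (abs_nonneg _) (pow_nonneg hA0 n)
  · exact integrable_config_of_abs_le (hwm.mul hg) (K := A ^ n * K) fun x => by
      rw [abs_mul]; exact mul_le_mul (abs_posWeight_le ha0 hA ε x) (hgK x) (abs_nonneg _) (pow_nonneg hA0 n)
  · exact mul_le_mul_of_nonneg_left (hle x) (posWeight_nonneg ha0 ε x)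

/-- **The Gibbs mean is affine**: `E[α f + β] = α E[f] + β` when `Z(a) > 0`. [folklore] -/
theorem gibbsMean_affine (ha : Measurable a) (ha0 : ∀ y, 0 ≤ a y) {A : ℝ} (hA : ∀ y, a y ≤ A)
    (hZ : 0 < posPartition a ε n) {f : (Fin n → T3) → ℝ} (hf : Measurable f) {K : ℝ} (hfK : ∀ x, |f x| ≤ K)
    (α β : ℝ) :
    (posPartition a ε n)⁻¹ * ∫ x, posWeight a ε n x * (α * f x + β) =
      α * ((posPartition a ε n)⁻¹ * ∫ x, posWeight a ε n x * f x) + β := by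
  have hA0 : 0 ≤ A := (ha0 0).trans (hA 0)
  have hwm := measurable_posWeight_of_measurable ha ε n
  have hwi : Integrable (posWeight a ε n) := integrable_config_of_abs_le hwm (abs_posWeight_le ha0 hA ε)
  have hwf : Integrable fun x => posWeight a ε n x * f x :=
    integrable_config_of_abs_le (hwm.mul hf) (K := A ^ n * K) fun x => by
      rw [abs_mul]; exact mul_le_mul (abs_posWeight_le ha0 hA ε x) (hfK x) (abs_nonneg _) (pow_nonneg hA0 n)
  have h : (fun x => posWeight a ε n x * (α * f x + β)) = fun x => α * (posWeight a ε n x * f x) + β * posWeight a ε n x := by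
    funext x; ring
  rw [h, integral_add (hwf.const_mul α) (hwi.const_mul β), integral_const_mul, integral_const_mul, ← posPartition,
    mul_add]
  congr 1
  · ring
  · field_simp

/-- The empirical average of `α g + β` is `α` times the average of `g` plus `β` (`n ≥ 1`). [folklore] -/
theorem avg_affine (hn : 0 < n) (g : T3 → ℝ) (α β : ℝ) (x : Fin n → T3) :
    (n : ℝ)⁻¹ * ∑ i, (α * g (x i) + β) = α * ((n : ℝ)⁻¹ * ∑ i, g (x i)) + β := by
  have hn' : (n : ℝ) ≠ 0 := by exact_mod_cast hn.ne'
  rw [Finset.sum_add_distrib, Finset.sum_const, Finset.card_univ, Fintype.card_fin, nsmul_eq_mul,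
    ← Finset.mul_sum]
  field_simp

/-! ### The convexity inequality for a perturbed field -/

/-- **Convexity inequality for a perturbed field.** For a measurable activity `0 ≤ a ≤ A` with
`Z(a) > 0`, bounded measurable `ψ`, `χ`, and reals `s, κ, T ≥ 0` with `s(χ − κ) − T ≤ ψ` pointwise:
`s E_a[(n)⁻¹∑χ] ≤ (n)⁻¹ (log Z(a e^ψ) − log Z(a)) + sκ + T` — Jensen's lower bound
(`log_posPartition_tilt_ge`) evaluated on the dominated empirical average. [folklore] -/
theorem gibbsMean_perturb_le (ha : Measurable a) (ha0 : ∀ y, 0 ≤ a y) {A : ℝ} (hA : ∀ y, a y ≤ A)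
    (ε : ℝ) (hn : 0 < n) (hZ : 0 < posPartition a ε n) {ψ χ : T3 → ℝ} (hψm : Measurable ψ) {Bψ : ℝ}
    (hψB : ∀ y, |ψ y| ≤ Bψ) (hχm : Measurable χ) {Cχ : ℝ} (hCχ : ∀ y, |χ y| ≤ Cχ) {s κ T : ℝ}
    (hT : 0 ≤ T) (hdom : ∀ y, s * (χ y - κ) - T ≤ ψ y) :
    s * ((posPartition a ε n)⁻¹ * ∫ x, posWeight a ε n x * ((n : ℝ)⁻¹ * ∑ i, χ (x i))) ≤
      (n : ℝ)⁻¹ * (Real.log (posPartition (fun y => a y * Real.exp (ψ y)) ε n) - Real.log (posPartition a ε n)) +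
        s * κ + T := by
  have hJ := log_posPartition_tilt_ge ha ha0 hA hψm hψB ε n hZ
  have hn0 : (0 : ℝ) ≤ (n : ℝ)⁻¹ := by positivity
  -- the dominated empirical average
  have hlow : ∀ x : Fin n → T3,
      s * ((n : ℝ)⁻¹ * ∑ i, χ (x i)) + (-(s * κ) - T) ≤ (n : ℝ)⁻¹ * ∑ i, ψ (x i) := by
    intro x
    rw [← avg_affine hn]
    refine mul_le_mul_of_nonneg_left (Finset.sum_le_sum fun i _ => ?_) hn0
    have h := hdom (x i)
    linarith
  have hCavg : ∀ x : Fin n → T3, |(n : ℝ)⁻¹ * ∑ i, χ (x i)| ≤ Cχ := fun x => abs_avg_le hn hCχ x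
  have hBψ0 : 0 ≤ Bψ := (abs_nonneg _).trans (hψB 0)
  have hCχ0 : 0 ≤ Cχ := (abs_nonneg _).trans (hCχ 0)
  have hmono := gibbsMean_mono (ε := ε) ha ha0 hA
    (f := fun x => s * ((n : ℝ)⁻¹ * ∑ i, χ (x i)) + (-(s * κ) - T)) (g := fun x => (n : ℝ)⁻¹ * ∑ i, ψ (x i))
    ((measurable_const.mul (measurable_const.mul (measurable_sum_apply hχm))).add measurable_const)
    (measurable_const.mul (measurable_sum_apply hψm)) (K := |s| * Cχ + (|s * κ| + T) + Bψ)
    (fun x => ?_) (fun x => ?_) hlow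
  rotate_left
  · have h1 : |s * ((n : ℝ)⁻¹ * ∑ i, χ (x i))| ≤ |s| * Cχ := by
      rw [abs_mul]; exact mul_le_mul_of_nonneg_left (hCavg x) (abs_nonneg _)
    have h2 : |(-(s * κ) - T)| ≤ |s * κ| + T := by
      calc |(-(s * κ) - T)| ≤ |-(s * κ)| + |T| := abs_sub _ _
        _ = |s * κ| + T := by rw [abs_neg, abs_of_nonneg hT]
    calc _ ≤ |s * ((n : ℝ)⁻¹ * ∑ i, χ (x i))| + |(-(s * κ) - T)| := abs_add_le _ _
      _ ≤ |s| * Cχ + (|s * κ| + T) := add_le_add h1 h2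
      _ ≤ _ := by linarith
  · calc |(n : ℝ)⁻¹ * ∑ i, ψ (x i)| ≤ Bψ := abs_avg_le hn hψB x
      _ ≤ _ := by have := abs_nonneg (s * κ); have := abs_nonneg s; nlinarith
  have haff := gibbsMean_affine (ε := ε) ha ha0 hA hZ (f := fun x => (n : ℝ)⁻¹ * ∑ i, χ (x i))
    (measurable_const.mul (measurable_sum_apply hχm)) hCavg s (-(s * κ) - T)
  rw [haff] at hmono
  -- Jensen, divided by `n`
  have havg : (fun x => posWeight a ε n x * ((n : ℝ)⁻¹ * ∑ i, ψ (x i))) =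
      fun x => (n : ℝ)⁻¹ * (posWeight a ε n x * ∑ i, ψ (x i)) := by funext x; ring
  have hJ' : (posPartition a ε n)⁻¹ * ∫ x, posWeight a ε n x * ((n : ℝ)⁻¹ * ∑ i, ψ (x i)) ≤
      (n : ℝ)⁻¹ * (Real.log (posPartition (fun y => a y * Real.exp (ψ y)) ε n) - Real.log (posPartition a ε n)) := by
    rw [havg, integral_const_mul, ← mul_assoc, mul_comm _ (n : ℝ)⁻¹, mul_assoc]
    exact mul_le_mul_of_nonneg_left hJ hn0
  linarith [hmono.trans hJ']

/-! ### Second-order Taylor control of an integral functional -/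

/-- **Second-order Taylor bound for `∫ v(ρ + s w)`.** If `v′ = v₁`, `v₁′ = deriv v₁` with
`|deriv v₁| ≤ K` on a band containing `ρ` and `ρ + s w`, and `|w| ≤ W`, then
`|∫ v(ρ + sw) − ∫ v(ρ) − ∫ v₁(ρ)·(sw)| ≤ K W² s²` (on the unit-volume torus). [folklore] -/
theorem integral_taylor_le {v v₁ : ℝ → ℝ} {lo hi K W s : ℝ} (hv : ∀ t ∈ Icc lo hi, HasDerivAt v (v₁ t) t)
    (hv₁ : ∀ t ∈ Icc lo hi, HasDerivAt v₁ (deriv v₁ t) t) (hK : ∀ t ∈ Icc lo hi, |deriv v₁ t| ≤ K) (hK0 : 0 ≤ K)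
    {ρ w : T3 → ℝ} (hρ : ∀ x, ρ x ∈ Icc lo hi) (hρs : ∀ x, ρ x + s * w x ∈ Icc lo hi) (hW : ∀ x, |w x| ≤ W)
    (hi₁ : Integrable fun x => v (ρ x + s * w x)) (hi₂ : Integrable fun x => v (ρ x))
    (hi₃ : Integrable fun x => v₁ (ρ x) * (s * w x)) :
    |(∫ x, v (ρ x + s * w x)) - (∫ x, v (ρ x)) - ∫ x, v₁ (ρ x) * (s * w x)| ≤ K * W ^ 2 * s ^ 2 := by
  have hpt : ∀ x, |v (ρ x + s * w x) - v (ρ x) - v₁ (ρ x) * (s * w x)| ≤ K * W ^ 2 * s ^ 2 := by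
    intro x
    have hseg : uIcc (ρ x) (ρ x + s * w x) ⊆ Icc lo hi := uIcc_subset_Icc (hρ x) (hρs x)
    have h := abs_sub_sub_mul_le_of_deriv (f := v) (f₁ := v₁) (f₂ := deriv v₁) (K := K) (x := ρ x) (y := ρ x + s * w x)
      (fun t ht => hv t (hseg ht)) (fun t ht => hv₁ t (hseg ht)) (fun t ht => hK t (hseg ht))
    have e1 : ρ x + s * w x - ρ x = s * w x := by ring
    rw [e1] at h
    have hwsq : w x ^ 2 ≤ W ^ 2 := by
      rw [← sq_abs (w x)]; exact pow_le_pow_left₀ (abs_nonneg _) (hW x) 2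
    calc |v (ρ x + s * w x) - v (ρ x) - v₁ (ρ x) * (s * w x)| ≤ K * (s * w x) ^ 2 := h
      _ = K * (w x ^ 2 * s ^ 2) := by ring
      _ ≤ K * (W ^ 2 * s ^ 2) := mul_le_mul_of_nonneg_left (mul_le_mul_of_nonneg_right hwsq (sq_nonneg s)) hK0
      _ = K * W ^ 2 * s ^ 2 := by ring
  have hi12 : Integrable fun x => v (ρ x + s * w x) - v (ρ x) := hi₁.sub hi₂
  rw [← integral_sub hi₁ hi₂, ← integral_sub hi12 hi₃]
  refine (abs_integral_le_integral_abs).trans ?_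
  calc (∫ x, |v (ρ x + s * w x) - v (ρ x) - v₁ (ρ x) * (s * w x)|) ≤ ∫ _ : T3, K * W ^ 2 * s ^ 2 :=
        integral_mono_of_nonneg (Eventually.of_forall fun x => abs_nonneg _) (integrable_const _) (Eventually.of_forall hpt)
    _ = K * W ^ 2 * s ^ 2 := by rw [integral_const, smul_eq_mul, probReal_univ, one_mul]

/-! ### The real-variable endgame -/

/-- **Two-sided perturbation pins the limit.** If for `|s| ≤ s₀` and all `N`,
`s E_N ≤ Λ_N(s) − Λ_N(0) + sκ + A s²`, `Λ_N(s) → V(s)`, and `|V(s) − V(0) − s(J − κ)| ≤ B s²`, then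
`E_N → J` (divide by `±s` and let `s → 0`). [folklore] -/
theorem tendsto_of_twoSided_perturbation {EN : ℕ → ℝ} {Λ : ℝ → ℕ → ℝ} {V : ℝ → ℝ} {J κ A B s₀ : ℝ}
    (hs₀ : 0 < s₀) (hA : 0 ≤ A) (hB : 0 ≤ B)
    (hstar : ∀ s : ℝ, |s| ≤ s₀ → ∀ N : ℕ, s * EN N ≤ Λ s N - Λ 0 N + s * κ + A * s ^ 2)
    (hlim : ∀ s : ℝ, |s| ≤ s₀ → Tendsto (Λ s) atTop (𝓝 (V s)))
    (hstar2 : ∀ s : ℝ, |s| ≤ s₀ → |V s - V 0 - s * (J - κ)| ≤ B * s ^ 2) :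
    Tendsto EN atTop (𝓝 J) := by
  rw [Metric.tendsto_atTop]
  intro e he
  -- the step `s`
  obtain ⟨s, hs0, hss₀, hse⟩ : ∃ s : ℝ, 0 < s ∧ s ≤ s₀ ∧ (A + B) * s ≤ e / 4 := by
    refine ⟨min s₀ (e / (4 * (A + B + 1))), lt_min hs₀ (by positivity), min_le_left _ _, ?_⟩
    have hD : 0 < A + B + 1 := by positivity
    calc (A + B) * min s₀ (e / (4 * (A + B + 1))) ≤ (A + B) * (e / (4 * (A + B + 1))) :=
          mul_le_mul_of_nonneg_left (min_le_right _ _) (by positivity)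
      _ ≤ (A + B + 1) * (e / (4 * (A + B + 1))) := mul_le_mul_of_nonneg_right (by linarith) (by positivity)
      _ = e / 4 := by field_simp
  have hsabs : |s| ≤ s₀ := by rw [abs_of_pos hs0]; exact hss₀
  have hsabs' : |(-s)| ≤ s₀ := by rw [abs_neg]; exact hsabs
  have h0abs : |(0 : ℝ)| ≤ s₀ := by rw [abs_zero]; exact hs₀.le
  have hes : 0 < e * s / 4 := by positivity
  have h1 := hlim s hsabs
  have h2 := hlim (-s) hsabs'
  have h3 := hlim 0 h0abs
  rw [Metric.tendsto_atTop] at h1 h2 h3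
  obtain ⟨N₁, hN₁⟩ := h1 _ hes
  obtain ⟨N₂, hN₂⟩ := h2 _ hes
  obtain ⟨N₃, hN₃⟩ := h3 _ hes
  refine ⟨max (max N₁ N₂) N₃, fun N hN => ?_⟩
  have hN1 : N₁ ≤ N := (le_max_left _ _).trans ((le_max_left _ _).trans hN)
  have hN2 : N₂ ≤ N := (le_max_right _ _).trans ((le_max_left _ _).trans hN)
  have hN3 : N₃ ≤ N := (le_max_right _ _).trans hN
  have d1 := abs_lt.1 (Real.dist_eq _ _ ▸ hN₁ N hN1)
  have d2 := abs_lt.1 (Real.dist_eq _ _ ▸ hN₂ N hN2)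
  have d3 := abs_lt.1 (Real.dist_eq _ _ ▸ hN₃ N hN3)
  have u1 := hstar s hsabs N
  have u2 := hstar (-s) hsabs' N
  have t1 := abs_le.1 (hstar2 s hsabs)
  have t2 := abs_le.1 (hstar2 (-s) hsabs')
  have hss : (-s) ^ 2 = s ^ 2 := by ring
  rw [hss] at u2 t2
  rw [Real.dist_eq, abs_lt]
  constructor
  · -- lower bound: from `-s`
    have hΛ₁ : Λ (-s) N - Λ 0 N ≤ V (-s) - V 0 + e * s / 2 := by linarith [d2.2, d3.1]
    have key : -s * EN N ≤ -s * J + (A + B) * s ^ 2 + e * s / 2 := by nlinarith [u2, t2.2, hΛ₁]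
    have key2 : s * (J - EN N) ≤ s * ((A + B) * s + e / 2) := by nlinarith [key]
    have key3 : J - EN N ≤ (A + B) * s + e / 2 := le_of_mul_le_mul_left key2 hs0
    linarith
  · -- upper bound: from `s`
    have hΛ₁ : Λ s N - Λ 0 N ≤ V s - V 0 + e * s / 2 := by linarith [d1.2, d3.1]
    have key : s * EN N ≤ s * J + (A + B) * s ^ 2 + e * s / 2 := by nlinarith [u1, t1.2, hΛ₁]
    have key2 : s * (EN N - J) ≤ s * ((A + B) * s + e / 2) := by nlinarith [key]
    have key3 : EN N - J ≤ (A + B) * s + e / 2 := le_of_mul_le_mul_left key2 hs0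
    linarith

end Summit.AtomisticToContinuum.HydrodynamicLimit.Theorems.HardSphereLDA

end
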